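import Summits.CriticalPhenomena.PercolationContinuityZ3.Theorems.PercNearOneGluingNoHeavyLowerTailAntitheticHangBlock
import HarnessLib

/-!
# `NoHeavyLowerTail` (stmt-CriticalPhenomena-4575) — antithetic cluster pairs: SERIES COMPOSITION of box partitions and the BRIDGE RULE
# (the "block path" closure of HOME/MEMO-gen63.md §5(d)/§6 (P1); prim-hp-2 gen 63)

Support file (`--supports stmt-CriticalPhenomena-4575`, hull-port prover `prim-hp-2`, gen 63).  No definitions, no named facts, no sorries;
standard axioms.  Notation of …AntitheticBoxes / …GlueSource / …HangBlock.  Together with `Box.boxes_glue_source`, `Box.boxes_hang`,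
`Box.boxes_leaves` and the cycle / θ theorems (`Cyc.ear_boxes`), the two results below certify the whole THEOREM-BOXABLE class of MEMO-gen63
§5(d) — "every block before the first bridge on the `s–P` path of the block-cut tree is an edge, a cycle, or a θ-graph with (entry, exit)
not its poles" — which explains 1 004 of the 1 190 box-decomposable `(K, s, P)` on ≤ 6 vertices, ≤ 8 edges (the other 186 are 2-connected
"cycle + 2 ears" blocks).
* `Antithetic.Box.dom_localize` — red domination stated for antipodes "opposite off `Fix`" only needs antipodes opposite on the pairs of `E`
  (clusters see `T ∩ E` only); used to run the domination of a factor inside a product box.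
* `Antithetic.Box.boxes_series` — **SERIES COMPOSITION**: `E₁ ∋ s` and `E₂` meet only at the cut vertex `c`, `s` off `E₂`, `P ≠ s` off `E₁`
  unless `P = c`; box partitions of `{c ∈ X_{E₁}}` (source `s`) and of `{P ∈ X_{E₂}}` (source `c`) give the PRODUCT partition of
  `{P ∈ X_{E₁ ∪ E₂}}` (source `s`): `Fix = Fix₁ ∪ Fix₂`.  Domination: `Y_{E₁∪E₂} T' ⊆ Y₁ T' ∪ [c ∈ Y₁ T']·Y₂^c T'` (`cluster_hang_subset`),
  `Y₁ T' ⊆ X₁ T`, and if `c ∈ Y₁ T'` then `c ∈ X₁ T` and `Y₂^c T' ⊆ X₂^c T`.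
* `Antithetic.Box.boxes_bridge` — **BRIDGE RULE**: if the only pair at `s` is a bridge `sc` (`E = {sc} ∪ E₂`, `s` off `E₂`), then for every
  `P ≠ s` the event `{P ∈ X_E}` is partitioned into red-dominated boxes: the bridge red and ALL pairs of `E₂` fixed (one box per colouring of
  `E₂` joining `c` to `P`) — the blue cluster of `s` is `{s}` in every member.  So beyond a bridge nothing is required.
[cite: VandenbergHaggstromKahn2005, §1 p. 3 (open cluster `C_s`)]
-/

noncomputable section

namespace Summit.CriticalPhenomena.PercolationContinuityZ3.Theorems

open Literature.Probability.Percolation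
open scoped Classical

namespace Antithetic

namespace Box

variable {V : Type*}

/-- **Localisation of red domination.**  If `Y_E T' ⊆ X_E T` holds for all members `T, T'` of the box `(Fix, N)` (`Fix ⊆ E`) that are
opposite off `Fix`, then it holds for members opposite on the pairs of `E ∖ Fix` only. [this work] -/
theorem dom_localize (E Fix N : Set (Sym2 V)) (s : V) (hFixE : Fix ⊆ E)
    (hdom : ∀ T T' : Set (Sym2 V), (∀ e ∈ Fix, (e ∈ T ↔ e ∈ N)) → (∀ e ∈ Fix, (e ∈ T' ↔ e ∈ N)) →
      (∀ e ∉ Fix, (e ∈ T' ↔ e ∉ T)) → openCluster (T'ᶜ ∩ E) s ⊆ openCluster (T ∩ E) s)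
    {T T' : Set (Sym2 V)} (hT : ∀ e ∈ Fix, (e ∈ T ↔ e ∈ N)) (hT' : ∀ e ∈ Fix, (e ∈ T' ↔ e ∈ N))
    (hflip : ∀ e ∈ E, e ∉ Fix → (e ∈ T' ↔ e ∉ T)) :
    openCluster (T'ᶜ ∩ E) s ⊆ openCluster (T ∩ E) s := by
  -- modify `T'` off `E` so that it is opposite to `T` there
  let T'' : Set (Sym2 V) := {e | (e ∈ E ∧ e ∈ T') ∨ (e ∉ E ∧ e ∉ T)}
  have h1 : ∀ e ∈ Fix, (e ∈ T'' ↔ e ∈ N) := by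
    intro e he
    have heE := hFixE he
    rw [← hT' e he]
    exact ⟨fun h => h.elim (fun h => h.2) (fun h => absurd heE h.1), fun h => Or.inl ⟨heE, h⟩⟩
  have h2 : ∀ e ∉ Fix, (e ∈ T'' ↔ e ∉ T) := by
    intro e he
    by_cases heE : e ∈ E
    · rw [← hflip e heE he]
      exact ⟨fun h => h.elim (fun h => h.2) (fun h => absurd heE h.1), fun h => Or.inl ⟨heE, h⟩⟩
    · exact ⟨fun h => h.elim (fun h => absurd h.1 heE) (fun h => h.2), fun h => Or.inr ⟨heE, h⟩⟩
  have h3 : T''ᶜ ∩ E = T'ᶜ ∩ E := by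
    ext e
    constructor
    · rintro ⟨h, he⟩
      exact ⟨fun hT'e => h (Or.inl ⟨he, hT'e⟩), he⟩
    · rintro ⟨h, he⟩
      exact ⟨fun h' => h'.elim (fun h' => h h'.2) (fun h' => h'.1 he), he⟩
  rw [← h3]
  exact hdom T T'' hT h1 h2

variable {E₁ E₂ : Set (Sym2 V)} {s c P : V}

/-- **Series composition of box partitions.**  `E₁`, `E₂` meet only at `c`; `s` is on no pair of `E₂`; `P ≠ s` is on no pair of `E₁`
unless `P = c`; no pair lies in both.  A red-dominated box partition of `{c ∈ X_{E₁}}` (source `s`, fixed pairs in `E₁`) and one of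
`{P ∈ X_{E₂}}` computed FROM `c` (fixed pairs in `E₂`) give the product partition of `{P ∈ X_{E₁ ∪ E₂}}` (source `s`):
`Fix (c₁,c₂) = Fix₁ c₁ ∪ Fix₂ c₂`, `N (c₁,c₂) = (N₁ c₁ ∩ Fix₁ c₁) ∪ (N₂ c₂ ∩ Fix₂ c₂)` — cover, inside, uniqueness, domination. [this work] -/
theorem boxes_series (hsep : ∀ e₁ ∈ E₁, ∀ e₂ ∈ E₂, ∀ x : V, x ∈ e₁ → x ∈ e₂ → x = c) (hsE : ∀ e ∈ E₂, s ∉ e)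
    (hPs : P ≠ s) (hPE : ∀ e ∈ E₁, P ∈ e → P = c) (hdisj : ∀ e ∈ E₁, e ∉ E₂)
    {C₁ : Type*} (Fix₁ N₁ : C₁ → Set (Sym2 V)) (hFixE₁ : ∀ c₁, Fix₁ c₁ ⊆ E₁)
    (hcover₁ : ∀ T : Set (Sym2 V), c ∈ openCluster (T ∩ E₁) s → ∃ c₁, ∀ e ∈ Fix₁ c₁, (e ∈ T ↔ e ∈ N₁ c₁))
    (hinside₁ : ∀ c₁ (T : Set (Sym2 V)), (∀ e ∈ Fix₁ c₁, (e ∈ T ↔ e ∈ N₁ c₁)) → c ∈ openCluster (T ∩ E₁) s)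
    (huniq₁ : ∀ c₁ c₁' (T : Set (Sym2 V)), (∀ e ∈ Fix₁ c₁, (e ∈ T ↔ e ∈ N₁ c₁)) → (∀ e ∈ Fix₁ c₁', (e ∈ T ↔ e ∈ N₁ c₁')) → c₁ = c₁')
    (hdom₁ : ∀ c₁ (T T' : Set (Sym2 V)), (∀ e ∈ Fix₁ c₁, (e ∈ T ↔ e ∈ N₁ c₁)) → (∀ e ∈ Fix₁ c₁, (e ∈ T' ↔ e ∈ N₁ c₁)) →
      (∀ e ∉ Fix₁ c₁, (e ∈ T' ↔ e ∉ T)) → openCluster (T'ᶜ ∩ E₁) s ⊆ openCluster (T ∩ E₁) s)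
    {C₂ : Type*} (Fix₂ N₂ : C₂ → Set (Sym2 V)) (hFixE₂ : ∀ c₂, Fix₂ c₂ ⊆ E₂)
    (hcover₂ : ∀ T : Set (Sym2 V), P ∈ openCluster (T ∩ E₂) c → ∃ c₂, ∀ e ∈ Fix₂ c₂, (e ∈ T ↔ e ∈ N₂ c₂))
    (hinside₂ : ∀ c₂ (T : Set (Sym2 V)), (∀ e ∈ Fix₂ c₂, (e ∈ T ↔ e ∈ N₂ c₂)) → P ∈ openCluster (T ∩ E₂) c)
    (huniq₂ : ∀ c₂ c₂' (T : Set (Sym2 V)), (∀ e ∈ Fix₂ c₂, (e ∈ T ↔ e ∈ N₂ c₂)) → (∀ e ∈ Fix₂ c₂', (e ∈ T ↔ e ∈ N₂ c₂')) → c₂ = c₂')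
    (hdom₂ : ∀ c₂ (T T' : Set (Sym2 V)), (∀ e ∈ Fix₂ c₂, (e ∈ T ↔ e ∈ N₂ c₂)) → (∀ e ∈ Fix₂ c₂, (e ∈ T' ↔ e ∈ N₂ c₂)) →
      (∀ e ∉ Fix₂ c₂, (e ∈ T' ↔ e ∉ T)) → openCluster (T'ᶜ ∩ E₂) c ⊆ openCluster (T ∩ E₂) c) :
    (∀ cc : C₁ × C₂, Fix₁ cc.1 ∪ Fix₂ cc.2 ⊆ E₁ ∪ E₂) ∧
    (∀ T : Set (Sym2 V), P ∈ openCluster (T ∩ (E₁ ∪ E₂)) s →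
      ∃ cc : C₁ × C₂, ∀ e ∈ Fix₁ cc.1 ∪ Fix₂ cc.2, (e ∈ T ↔ e ∈ (N₁ cc.1 ∩ Fix₁ cc.1) ∪ (N₂ cc.2 ∩ Fix₂ cc.2))) ∧
    (∀ (cc : C₁ × C₂) (T : Set (Sym2 V)), (∀ e ∈ Fix₁ cc.1 ∪ Fix₂ cc.2, (e ∈ T ↔ e ∈ (N₁ cc.1 ∩ Fix₁ cc.1) ∪ (N₂ cc.2 ∩ Fix₂ cc.2))) →
      P ∈ openCluster (T ∩ (E₁ ∪ E₂)) s) ∧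
    (∀ (cc cc' : C₁ × C₂) (T : Set (Sym2 V)),
      (∀ e ∈ Fix₁ cc.1 ∪ Fix₂ cc.2, (e ∈ T ↔ e ∈ (N₁ cc.1 ∩ Fix₁ cc.1) ∪ (N₂ cc.2 ∩ Fix₂ cc.2))) →
      (∀ e ∈ Fix₁ cc'.1 ∪ Fix₂ cc'.2, (e ∈ T ↔ e ∈ (N₁ cc'.1 ∩ Fix₁ cc'.1) ∪ (N₂ cc'.2 ∩ Fix₂ cc'.2))) → cc = cc') ∧
    (∀ (cc : C₁ × C₂) (T T' : Set (Sym2 V)),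
      (∀ e ∈ Fix₁ cc.1 ∪ Fix₂ cc.2, (e ∈ T ↔ e ∈ (N₁ cc.1 ∩ Fix₁ cc.1) ∪ (N₂ cc.2 ∩ Fix₂ cc.2))) →
      (∀ e ∈ Fix₁ cc.1 ∪ Fix₂ cc.2, (e ∈ T' ↔ e ∈ (N₁ cc.1 ∩ Fix₁ cc.1) ∪ (N₂ cc.2 ∩ Fix₂ cc.2))) →
      (∀ e ∉ Fix₁ cc.1 ∪ Fix₂ cc.2, (e ∈ T' ↔ e ∉ T)) →
      openCluster (T'ᶜ ∩ (E₁ ∪ E₂)) s ⊆ openCluster (T ∩ (E₁ ∪ E₂)) s) := by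
  -- membership in a product box = membership in both factors
  have hmem : ∀ (c₁ : C₁) (c₂ : C₂) (T : Set (Sym2 V)),
      (∀ e ∈ Fix₁ c₁ ∪ Fix₂ c₂, (e ∈ T ↔ e ∈ (N₁ c₁ ∩ Fix₁ c₁) ∪ (N₂ c₂ ∩ Fix₂ c₂))) ↔
        ((∀ e ∈ Fix₁ c₁, (e ∈ T ↔ e ∈ N₁ c₁)) ∧ (∀ e ∈ Fix₂ c₂, (e ∈ T ↔ e ∈ N₂ c₂))) := by
    intro c₁ c₂ T
    have hx1 : ∀ e ∈ Fix₁ c₁, e ∉ Fix₂ c₂ := fun e he he' => hdisj e (hFixE₁ c₁ he) (hFixE₂ c₂ he')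
    have hx2 : ∀ e ∈ Fix₂ c₂, e ∉ Fix₁ c₁ := fun e he he' => hdisj e (hFixE₁ c₁ he') (hFixE₂ c₂ he)
    constructor
    · intro h
      refine ⟨fun e he => ?_, fun e he => ?_⟩
      · rw [h e (Or.inl he)]
        exact ⟨fun h' => h'.elim (fun h' => h'.1) (fun h' => absurd h'.2 (hx1 e he)), fun h' => Or.inl ⟨h', he⟩⟩
      · rw [h e (Or.inr he)]
        exact ⟨fun h' => h'.elim (fun h' => absurd h'.2 (hx2 e he)) (fun h' => h'.1), fun h' => Or.inr ⟨h', he⟩⟩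
    · rintro ⟨h1, h2⟩ e (he | he)
      · rw [h1 e he]
        exact ⟨fun h' => Or.inl ⟨h', he⟩, fun h' => h'.elim (fun h' => h'.1) (fun h' => absurd h'.2 (hx1 e he))⟩
      · rw [h2 e he]
        exact ⟨fun h' => Or.inr ⟨h', he⟩, fun h' => h'.elim (fun h' => absurd h'.2 (hx2 e he)) (fun h' => h'.1)⟩
  have hmono₁ : ∀ G : Set (Sym2 V), openCluster (G ∩ E₁) s ⊆ openCluster (G ∩ (E₁ ∪ E₂)) s :=
    fun G => Freeze.openCluster_mono (Set.inter_subset_inter_right _ Set.subset_union_left) _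
  have hle₂ : ∀ G : Set (Sym2 V), openGraph (G ∩ E₂) ≤ openGraph (G ∩ (E₁ ∪ E₂)) := by
    intro G a b hab
    rw [openGraph_adj] at hab ⊢
    exact ⟨⟨hab.1.1, Or.inr hab.1.2⟩, hab.2⟩
  refine ⟨fun cc => Set.union_subset_union (hFixE₁ cc.1) (hFixE₂ cc.2), ?_, ?_, ?_, ?_⟩
  · -- cover
    intro T hP
    have hsplit : c ∈ openCluster (T ∩ E₁) s ∧ P ∈ openCluster (T ∩ E₂) c := by
      rcases cluster_hang_subset hsep hsE T hP with h1 | ⟨hc, hP2⟩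
      · obtain ⟨e, he, hPe⟩ := mem_pair_of_mem_cluster h1 hPs
        have hPc : P = c := hPE e he hPe
        subst hPc
        exact ⟨h1, mem_openCluster_self _ _⟩
      · exact ⟨hc, hP2⟩
    obtain ⟨c₁, h1⟩ := hcover₁ T hsplit.1
    obtain ⟨c₂, h2⟩ := hcover₂ T hsplit.2
    exact ⟨(c₁, c₂), (hmem c₁ c₂ T).2 ⟨h1, h2⟩⟩
  · -- inside
    rintro ⟨c₁, c₂⟩ T hT
    obtain ⟨h1, h2⟩ := (hmem c₁ c₂ T).1 hT
    exact (hmono₁ T (hinside₁ c₁ T h1)).trans ((hinside₂ c₂ T h2).mono (hle₂ T))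
  · -- uniqueness
    rintro ⟨c₁, c₂⟩ ⟨c₁', c₂'⟩ T hT hT'
    obtain ⟨h1, h2⟩ := (hmem c₁ c₂ T).1 hT
    obtain ⟨h1', h2'⟩ := (hmem c₁' c₂' T).1 hT'
    rw [huniq₁ c₁ c₁' T h1 h1', huniq₂ c₂ c₂' T h2 h2']
  · -- red domination
    rintro ⟨c₁, c₂⟩ T T' hT hT' hflip y hy
    obtain ⟨hT1, hT2⟩ := (hmem c₁ c₂ T).1 hT
    obtain ⟨hT'1, hT'2⟩ := (hmem c₁ c₂ T').1 hT'
    have hY₁ : openCluster (T'ᶜ ∩ E₁) s ⊆ openCluster (T ∩ E₁) s :=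
      dom_localize E₁ (Fix₁ c₁) (N₁ c₁) s (hFixE₁ c₁) (hdom₁ c₁) hT1 hT'1
        fun e he hF => hflip e fun h => h.elim hF fun h2 => hdisj e he (hFixE₂ c₂ h2)
    have hY₂ : openCluster (T'ᶜ ∩ E₂) c ⊆ openCluster (T ∩ E₂) c :=
      dom_localize E₂ (Fix₂ c₂) (N₂ c₂) c (hFixE₂ c₂) (hdom₂ c₂) hT2 hT'2
        fun e he hF => hflip e fun h => h.elim (fun h1 => hdisj e (hFixE₁ c₁ h1) he) hF
    rcases cluster_hang_subset hsep hsE T'ᶜ hy with h1 | ⟨hc, hy2⟩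
    · exact hmono₁ T (hY₁ h1)
    · exact (hmono₁ T (hY₁ hc)).trans ((hY₂ hy2).mono (hle₂ T))

/-- **Bridge rule.**  Let `E = {sc} ∪ E₂` with `s ≠ c`, `s` on no pair of `E₂`, and `P ≠ s`.  Then `{P ∈ X_E}` is partitioned into
red-dominated boxes indexed by the colourings `T₂ ⊆ E₂` with `P ∈ X_{{sc} ∪ T₂}`: `Fix = E` (everything fixed), `N = {sc} ∪ T₂`; in every
member the blue cluster of `s` is `{s}` (cover / inside / uniqueness / domination). [this work] -/
theorem boxes_bridge (hsE : ∀ e ∈ E₂, s ∉ e) (hPs : P ≠ s) :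
    (∀ _ : {T₂ : Set (Sym2 V) // T₂ ⊆ E₂ ∧ P ∈ openCluster (insert s(s, c) T₂) s},
      (insert s(s, c) E₂ : Set (Sym2 V)) ⊆ insert s(s, c) E₂) ∧
    (∀ T : Set (Sym2 V), P ∈ openCluster (T ∩ insert s(s, c) E₂) s →
      ∃ T₂ : {T₂ : Set (Sym2 V) // T₂ ⊆ E₂ ∧ P ∈ openCluster (insert s(s, c) T₂) s},
        ∀ e ∈ insert s(s, c) E₂, (e ∈ T ↔ e ∈ insert s(s, c) T₂.1)) ∧
    (∀ (T₂ : {T₂ : Set (Sym2 V) // T₂ ⊆ E₂ ∧ P ∈ openCluster (insert s(s, c) T₂) s}) (T : Set (Sym2 V)),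
      (∀ e ∈ insert s(s, c) E₂, (e ∈ T ↔ e ∈ insert s(s, c) T₂.1)) → P ∈ openCluster (T ∩ insert s(s, c) E₂) s) ∧
    (∀ (T₂ T₂' : {T₂ : Set (Sym2 V) // T₂ ⊆ E₂ ∧ P ∈ openCluster (insert s(s, c) T₂) s}) (T : Set (Sym2 V)),
      (∀ e ∈ insert s(s, c) E₂, (e ∈ T ↔ e ∈ insert s(s, c) T₂.1)) →
      (∀ e ∈ insert s(s, c) E₂, (e ∈ T ↔ e ∈ insert s(s, c) T₂'.1)) → T₂ = T₂') ∧
    (∀ (T₂ : {T₂ : Set (Sym2 V) // T₂ ⊆ E₂ ∧ P ∈ openCluster (insert s(s, c) T₂) s}) (T T' : Set (Sym2 V)),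
      (∀ e ∈ insert s(s, c) E₂, (e ∈ T ↔ e ∈ insert s(s, c) T₂.1)) →
      (∀ e ∈ insert s(s, c) E₂, (e ∈ T' ↔ e ∈ insert s(s, c) T₂.1)) →
      (∀ e ∉ insert s(s, c) E₂, (e ∈ T' ↔ e ∉ T)) →
      openCluster (T'ᶜ ∩ insert s(s, c) E₂) s ⊆ openCluster (T ∩ insert s(s, c) E₂) s) := by
  have hbr : s(s, c) ∉ E₂ := fun h => hsE _ h (Sym2.mem_mk_left _ _)
  -- the only pair of `E` at `s` is the bridge
  have hat : ∀ (G : Set (Sym2 V)) (y : V), y ∈ openCluster (G ∩ insert s(s, c) E₂) s → y ≠ s → s(s, c) ∈ G := by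
    intro G y hy hys
    obtain ⟨w, hw, -⟩ := Glue.exists_pair_of_reachable (G ∩ insert s(s, c) E₂) hys.symm hy
    rcases hw.2 with h | h
    · exact h ▸ hw.1
    · exact absurd (Sym2.mem_mk_left _ _) (hsE _ h)
  refine ⟨fun _ => subset_rfl, ?_, ?_, ?_, ?_⟩
  · -- cover
    intro T hP
    have hbT : s(s, c) ∈ T := hat T P hP hPs
    have hsub : T ∩ insert s(s, c) E₂ ⊆ insert s(s, c) (T ∩ E₂) := by
      rintro e ⟨heT, he | he⟩
      · exact Or.inl he
      · exact Or.inr ⟨heT, he⟩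
    refine ⟨⟨T ∩ E₂, Set.inter_subset_right, Freeze.openCluster_mono hsub _ hP⟩, fun e he => ?_⟩
    rcases he with rfl | he
    · exact ⟨fun _ => Or.inl rfl, fun _ => hbT⟩
    · exact ⟨fun h => Or.inr ⟨h, he⟩, fun h => h.elim (fun h => h ▸ hbT) (fun h => h.1)⟩
  · -- inside
    rintro ⟨T₂, hT₂E, hT₂P⟩ T hT
    refine Freeze.openCluster_mono (fun e he => ?_) _ hT₂P
    have heE : e ∈ insert s(s, c) E₂ := he.elim (fun h => Or.inl h) (fun h => Or.inr (hT₂E h))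
    exact ⟨(hT e heE).2 he, heE⟩
  · -- uniqueness
    rintro ⟨T₂, hT₂E, hT₂P⟩ ⟨T₃, hT₃E, hT₃P⟩ T hT hU
    apply Subtype.ext
    ext e
    constructor
    · intro he
      have heT : e ∈ T := (hT e (Or.inr (hT₂E he))).2 (Or.inr he)
      rcases (hU e (Or.inr (hT₂E he))).1 heT with h | h
      · exact absurd (hT₂E he) (h ▸ hbr)
      · exact h
    · intro he
      have heT : e ∈ T := (hU e (Or.inr (hT₃E he))).2 (Or.inr he)
      rcases (hT e (Or.inr (hT₃E he))).1 heT with h | h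
      · exact absurd (hT₃E he) (h ▸ hbr)
      · exact h
  · -- red domination: the blue cluster of `s` is `{s}` (the bridge is red in `T'`)
    rintro T₂ T T' - hT' - y hy
    by_cases hys : y = s
    · rw [hys]; exact mem_openCluster_self _ _
    · exact absurd ((hT' _ (Or.inl rfl)).2 (Or.inl rfl)) (hat T'ᶜ y hy hys)

end Box

end Antithetic

end Summit.CriticalPhenomena.PercolationContinuityZ3.Theorems
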